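import Summits.ResolutionOfSingularities.ResolutionOfSingularities.Theorems.HilbertSamuelEliminationSigmaMaxModificationsCorridor3WLadderE1GeneralTransversal
import Summits.ResolutionOfSingularities.ResolutionOfSingularities.Theorems.HilbertSamuelEliminationSigmaMaxModificationsCorridor3WLadderE1Tower
import Summits.ResolutionOfSingularities.ResolutionOfSingularities.Theorems.HilbertSamuelEliminationSigmaMaxModificationsCorridor3WLadderIsoTailsFreeRationalIdeal
import Literature.RingTheory.HilbertSamuel.RegularCriterion
import Literature.AlgebraicGeometry.Resolution.NearPointTauMonotone
import HarnessLib

/-!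
# [OURS · L1 W4.2] The `e = 1` door OUTSIDE the hypersurface cell, step 4 — **ONE `e = 1` NEAR STEP IS FREE AND THE TRANSVERSAL
# PRESENTATION PROPAGATES, FOR AN ARBITRARY KERNEL** (every embedding dimension)
# (crux `SigmaMaxModifications` stmt-ResolutionOfSingularities-18506 / conjunct stmt-…-19249, line `w_ladder_rows` v8.5, row `stub_twoClaims` (β);
# `--supports 19249`, helper)

Stub worker res-L1-w42-stub-3 (gen 6). Sorry-free PROOF file, no definition, no named fact. OURS bookkeeping for the W4.2 crux chain
(cell res-hironaka); NOT a statement of [Hironaka2017] nor of [CossartJannsenSaito2020]. AI-written; AI review is weaker than expert review.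

`E1Free.exists_presentation_step_ideal` — the arbitrary-kernel twin of `E1Free.exists_presentation_step` (p543545, hypersurface cell). DATA at
`x = π(x′)` of a blow-up `π` with centre ideal `𝔪_x`: ANY surjection `σ : R ↠ 𝒪_{X,x}` from a regular local ring `R` with regular system of
parameters `c` and `emb.dim R = emb.dim 𝒪_{X,x} = d`, whose slot `j₀` is TRANSVERSAL (`X_{j₀} ∉ 𝒯(J(σ ∘ c))`); HYPOTHESES `e_x = 1`, `x′ ∈ ℙ(Dir_x)`,
`H^{(0)}(𝒪_{x′}) = H^{(0)}(𝒪_x)` (near) and `e_{x′} ≥ 1`. CONCLUSION: the exceptional ideal `𝔪_x·𝒪_{x′}` is `(π♯σ(c_{j₀}))` (the point is in the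
`c_{j₀}`-chart), and the same data at `x′` — res-type-071's arbitrary-kernel step `EmbeddedStep.exists_maximalIdeal_presentation_ideal` (p-landed,
`…IsoTailsFreeRationalIdeal`) supplies `σ′ : R′ ↠ 𝒪_{X′,x′}` with `R′ = R[𝔪/c_{j₀}]_𝔑` regular of embedding dimension `d` and r.s.p. `y′` with
`y′_{j₀} = c_{j₀}/1`; `emb.dim 𝒪_{x′} = d` by nearness; and the slot `j₀` is TRANSVERSAL AGAIN by the Hilbert-function mechanism of
`…E1GeneralTransversal` (`X_notMem_directrixSpace_of_near`: LEMMA O puts `𝒯_x` inside `⊕_{k ≠ j₀}` in the shifted parameters, the chart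
relations `π♯σ(c̃_k) = π♯σ(t)·σ′(y′_k)` hold by construction). No hypersurface equation, no standard bases, no named fact.

[OURS · L1 W4.2; AI-written] [cite: CossartJannsenSaito2020, Def. 6.34 (i), Lemma 2.7, Def. 2.18] [cite: CossartPiltant2008, proof of Lemma 4.3 (3)]
-/

set_option linter.dupNamespace false

noncomputable section

open CategoryTheory AlgebraicGeometry TopologicalSpace IsLocalRing MvPolynomial Module
open Literature.RingTheory.MvPolynomial Literature.RingTheory.HilbertSamuel Literature.AlgebraicGeometry.Resolution
open Literature.AlgebraicGeometry.CossartJannsenSaito2020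
open Scheme.IdealSheafData
open Summit.ResolutionOfSingularities.ResolutionOfSingularities.Theorems.SigmaMaxModificationsCorridor3.Helpers
open Summit.ResolutionOfSingularities.ResolutionOfSingularities.Cruxes.SigmaMaxModifications.IdeasL1C5

namespace Summit.ResolutionOfSingularities.ResolutionOfSingularities.Theorems.SigmaMaxModificationsCorridor3.E1Free

universe u

/-! ## LEMMA S′ in step-data form (abstract rings; the scheme-level theorem instantiates it) -/

/-- **LEMMA S′ — transversality propagates (ring level, arbitrary kernel).** Surjections `σ : R ↠ A`, `σ′ : R′ ↠ A′` of local rings (`A`, `A′`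
Noetherian of embedding dimension `d`), generators `c` of `𝔪_R` and `y′` of `𝔪_{R′}`, linked by `ι : R → R′` and a local `φ : A → A′` with
`σ′ ∘ ι = φ ∘ σ`, the chart relations `y′_{j₀} = ι c̃_{j₀}`, `ι c̃_k = ι c̃_{j₀} · y′_k` for the shifted parameters `c̃ = shiftRsop c j₀ a`,
`φ σ(c_{j₀})` a non-zero-divisor, the point on `ℙ(Dir(A))` (`ProjDirLiftsInto φ (σ ∘ c̃)`), residue fields matched by `φ`, `H^{(0)}(A′) = H^{(0)}(A)`,
`e(A) = 1 ≤ e(A′)`. THEN the symbol `X_{j₀}` of `y′_{j₀}` is off the directrix space of `A′` in the generators `σ′ ∘ y′`. (LEMMA O ⇒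
`𝒯(J_A(σ ∘ c̃)) ≤ ⊕_{k≠j₀}`; then `X_notMem_directrixSpace_of_near`.) [OURS · L1 W4.2; AI-written] [cite: CossartJannsenSaito2020, Lemma 2.7, Def. 2.18, Def. 6.34 (i)] -/
theorem X_notMem_directrixSpace_of_stepData_ideal {R R' A A' : Type u} [CommRing R] [IsLocalRing R] [CommRing R'] [IsLocalRing R']
    [CommRing A] [IsLocalRing A] [IsNoetherianRing A] [CommRing A'] [IsLocalRing A'] [IsNoetherianRing A']
    {d : ℕ} (c : Fin d → R) (hc : Ideal.span (Set.range c) = maximalIdeal R) (j₀ : Fin d) (a : {k : Fin d // k ≠ j₀} → R)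
    (y' : Fin d → R') (hy' : Ideal.span (Set.range y') = maximalIdeal R')
    (ι : R →+* R') (hyj : y' j₀ = ι (shiftRsop c j₀ a j₀)) (hyk : ∀ k, k ≠ j₀ → ι (shiftRsop c j₀ a k) = ι (shiftRsop c j₀ a j₀) * y' k)
    (σ : R →+* A) (hσ : Function.Surjective σ) (σ' : R' →+* A') (hσ' : Function.Surjective σ')
    (φ : A →+* A') [IsLocalHom φ] (hφ : ∀ r, σ' (ι r) = φ (σ r))
    (hnzd : φ (σ (c j₀)) ∈ nonZeroDivisors A')
    (hPt : ProjDirLiftsInto φ (σ ∘ shiftRsop c j₀ a)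
      (span_range_comp_eq_maximalIdeal (by rw [span_range_shiftRsop, hc]) σ hσ))
    (hκ : Function.Bijective (IsLocalRing.ResidueField.map φ)) (hH : ∀ s, hilbertFun A' s = hilbertFun A s)
    (hdA : (maximalIdeal A).spanFinrank = d) (hdA' : (maximalIdeal A').spanFinrank = d)
    (he : dirDim A = 1) (he' : 1 ≤ dirDim A') :
    (X j₀ : MvPolynomial (Fin d) (ResidueField A')) ∉
      directrixSpace (tangentConeIdeal (σ' ∘ y') (span_range_comp_eq_maximalIdeal hy' σ' hσ')) := by
  classical
  set ct := shiftRsop c j₀ a with hctdef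
  have hct : Ideal.span (Set.range ct) = maximalIdeal R := by rw [hctdef, span_range_shiftRsop, hc]
  have hctj : ct j₀ = c j₀ := shiftRsop_self c j₀ a
  have hxAt : Ideal.span (Set.range (σ ∘ ct)) = maximalIdeal A := span_range_comp_eq_maximalIdeal hct σ hσ
  have hxA' : Ideal.span (Set.range (σ' ∘ y')) = maximalIdeal A' := span_range_comp_eq_maximalIdeal hy' σ' hσ'
  -- the intrinsic frame
  have hyjA : (σ' ∘ y') j₀ = φ ((σ ∘ ct) j₀) := by
    change σ' (y' j₀) = φ (σ (ct j₀))
    rw [hyj, hφ]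
  have hchart : ∀ k, k ≠ j₀ → φ ((σ ∘ ct) k) = φ ((σ ∘ ct) j₀) * (σ' ∘ y') k := by
    intro k hk
    change φ (σ (ct k)) = φ (σ (ct j₀)) * σ' (y' k)
    rw [← hφ, ← hφ, hyk k hk, map_mul]
  have hnzd' : φ ((σ ∘ ct) j₀) ∈ nonZeroDivisors A' := by
    change φ (σ (ct j₀)) ∈ _
    rw [hctj]; exact hnzd
  -- LEMMA O: at the origin of the `t`-chart, `ℙ(Dir)` forces `𝒯 ≤ ⊕_{k ≠ j₀}`
  have horig : ∀ k, k ≠ j₀ → φ ((σ ∘ ct) k) ∈ Ideal.span {φ ((σ ∘ ct) j₀)} * maximalIdeal A' := by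
    intro k hk
    rw [hchart k hk]
    have hykm : y' k ∈ maximalIdeal R' := hy'.le (Ideal.subset_span ⟨k, rfl⟩)
    have hσ'm : σ' (y' k) ∈ maximalIdeal A' := by
      have := Ideal.mem_map_of_mem σ' hykm
      rwa [IsLocalRing.map_maximalIdeal_of_surjective σ' hσ'] at this
    exact Ideal.mul_mem_mul (Ideal.mem_span_singleton_self _) hσ'm
  have hT : directrixSpace (tangentConeIdeal (σ ∘ ct) hxAt) ≤ Submodule.span (ResidueField A) (X '' {i | i ≠ j₀}) :=
    le_span_X_of_forall_coeff_eq_zero (directrixSpace_le_one _) j₀ fun L hL =>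
      coeff_eq_zero_of_projDirLiftsInto_origin φ hxAt j₀ horig hnzd' hPt hL
  have heA : directrixDim (tangentConeIdeal (σ ∘ ct) hxAt) ≤ 1 := by
    rw [← dirDim_eq' A hdA (σ ∘ ct) hxAt]; exact he.le
  have heA' : 1 ≤ directrixDim (tangentConeIdeal (σ' ∘ y') hxA') := by
    rw [← dirDim_eq' A' hdA' (σ' ∘ y') hxA']; exact he'
  exact X_notMem_directrixSpace_of_near hxAt hxA' j₀ φ hyjA hchart hnzd' hκ hH hT heA heA'

/-! ## The scheme-level step -/

set_option maxHeartbeats 800000 in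
-- long existential unpacking over the affine blowup algebra of a stalk (as in `…E1NearStep`)
/-- **ONE `e = 1` NEAR STEP, ARBITRARY KERNEL: the point is in the chart of the transversal parameter, and the transversal presentation of the
right embedding dimension propagates to the near point** (module docstring). [OURS · L1 W4.2; AI-written]
[cite: CossartJannsenSaito2020, Def. 6.34 (i), Lemma 2.7, Def. 2.18] [cite: CossartPiltant2008, proof of Lemma 4.3 (3)] -/
theorem exists_presentation_step_ideal {Y Y' : Scheme.{u}} [IsLocallyNoetherian Y] [IsLocallyNoetherian Y'] {π : Y' ⟶ Y}
    {D : Y.IdealSheafData} (hπ : IsBlowup π D) (x' : Y')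
    (hD : stalkIdeal D (π x') = maximalIdeal (Y.presheaf.stalk (π x')))
    (hcl : IsClosed ({π x'} : Set Y)) (hπpt : IsBlowup π (vanishingIdeal ⟨{π x'}, hcl⟩))
    {R : Type u} [CommRing R] [IsRegularLocalRing R] {d : ℕ} (hd : (maximalIdeal R).spanFinrank = d)
    (c : Fin d → R) (hc : Ideal.span (Set.range c) = maximalIdeal R)
    (σ : R →+* Y.presheaf.stalk (π x')) (hσ : Function.Surjective σ)
    (hdA : (maximalIdeal (Y.presheaf.stalk (π x'))).spanFinrank = d) (j₀ : Fin d)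
    (he : Scheme.dirDim Y (π x') = 1) (hon : IsOnProjDirectrix π x')
    (hHS : hilbertSamuelFun (Y'.presheaf.stalk x') 0 = hilbertSamuelFun (Y.presheaf.stalk (π x')) 0)
    (he' : 1 ≤ Scheme.dirDim Y' x')
    (htrans : (X j₀ : MvPolynomial (Fin d) (ResidueField (Y.presheaf.stalk (π x')))) ∉
      directrixSpace (tangentConeIdeal (σ ∘ c) (span_range_comp_eq_maximalIdeal hc σ hσ))) :
    ∃ (R' : Type u) (_ : CommRing R') (_ : IsRegularLocalRing R') (y' : Fin d → R') (σ' : R' →+* Y'.presheaf.stalk x')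
      (hy' : Ideal.span (Set.range y') = maximalIdeal R') (hσ' : Function.Surjective σ'),
      (maximalIdeal R').spanFinrank = d ∧ (maximalIdeal (Y'.presheaf.stalk x')).spanFinrank = d ∧
      σ' (y' j₀) = (π.stalkMap x').hom (σ (c j₀)) ∧
      (maximalIdeal (Y.presheaf.stalk (π x'))).map (π.stalkMap x').hom = Ideal.span {(π.stalkMap x').hom (σ (c j₀))} ∧
      (X j₀ : MvPolynomial (Fin d) (ResidueField (Y'.presheaf.stalk x'))) ∉
        directrixSpace (tangentConeIdeal (σ' ∘ y') (span_range_comp_eq_maximalIdeal hy' σ' hσ')) := by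
  classical
  have hxA : Ideal.span (Set.range (σ ∘ c)) = maximalIdeal (Y.presheaf.stalk (π x')) := span_range_comp_eq_maximalIdeal hc σ hσ
  -- (FREE): `𝔪_x · 𝒪_{x'} = (π♯ σ t)`
  have hE : (maximalIdeal (Y.presheaf.stalk (π x'))).map (π.stalkMap x').hom =
      Ideal.span {(π.stalkMap x').hom (σ (c j₀))} :=
    map_maximalIdeal_stalkMap_eq_span_of_transversal x' (σ ∘ c) hxA hdA j₀ he hon htrans
  have hfree : ∀ k, (π.stalkMap x').hom (σ (c j₀)) ∣ (π.stalkMap x').hom (σ (c k)) := by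
    intro k
    have hk : (π.stalkMap x').hom (σ (c k)) ∈ (maximalIdeal (Y.presheaf.stalk (π x'))).map (π.stalkMap x').hom :=
      Ideal.mem_map_of_mem _ (hxA.le (Ideal.subset_span ⟨k, rfl⟩))
    rw [hE] at hk
    exact Ideal.mem_span_singleton.mp hk
  -- (RAT): `x'` is the `κ(x)`-rational point `ℙ(Dir_x)`
  have hrat : Function.Surjective (IsLocalRing.ResidueField.map (π.stalkMap x').hom) :=
    residueField_map_surjective_of_isOnProjDirectrix x' hcl hπpt he hon
  haveI : IsLocalHom (π.stalkMap x').hom := π.toLRSHom.prop x'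
  -- res-type-071's arbitrary-kernel step: the presentation at `x'`
  obtain ⟨a, 𝔑, h𝔑max, σ', h1, h2, h3, h4, h5, h6, h7, h8, h9, h10, h11, h12, h13, h14, h15⟩ :=
    EmbeddedStep.exists_maximalIdeal_presentation_ideal c j₀ hπ x' hD hd hc σ hσ hfree hrat
  haveI : IsRegularLocalRing (Localization.AtPrime 𝔑) := h5
  set ι : R →+* Localization.AtPrime 𝔑 :=
    (algebraMap (blowupAlgebra (maximalIdeal R) (c j₀)) (Localization.AtPrime 𝔑)).comp
      (algebraMap R (blowupAlgebra (maximalIdeal R) (c j₀))) with hιdef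
  -- the new regular system of parameters `y'` (`t` in slot `j₀`)
  have hcm : ∀ k, c k ∈ maximalIdeal R := fun k => hc.le (Ideal.subset_span ⟨k, rfl⟩)
  obtain ⟨y', hy'def⟩ : ∃ y' : Fin d → Localization.AtPrime 𝔑, y' = fun k =>
      if hk : k = j₀ then algebraMap _ (Localization.AtPrime 𝔑) (algebraMap R (blowupAlgebra (maximalIdeal R) (c j₀)) (c j₀))
      else algebraMap _ (Localization.AtPrime 𝔑)
        (blowupAlgebra.gen (maximalIdeal R) (c j₀) (c k) (hc.le (Ideal.subset_span ⟨k, rfl⟩)) -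
          algebraMap R _ (a ⟨k, hk⟩)) := ⟨_, rfl⟩
  have hy' : Ideal.span (Set.range y') = maximalIdeal (Localization.AtPrime 𝔑) := by rw [hy'def]; exact h7
  have hyj : y' j₀ = ι (c j₀) := by rw [hy'def]; exact dif_pos rfl
  have hyk0 : ∀ k (hk : k ≠ j₀), y' k = algebraMap _ (Localization.AtPrime 𝔑)
      (blowupAlgebra.gen (maximalIdeal R) (c j₀) (c k) (hcm k) - algebraMap R _ (a ⟨k, hk⟩)) := fun k hk => by
    rw [hy'def]; exact dif_neg hk
  -- the chart relations for the shifted parameters `c̃_k = c_k − a_k t`: `ι c̃_k = ι t · y'_k`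
  have hctj : shiftRsop c j₀ a j₀ = c j₀ := shiftRsop_self c j₀ a
  have hyj' : y' j₀ = ι (shiftRsop c j₀ a j₀) := by rw [hctj]; exact hyj
  have hyk : ∀ k, k ≠ j₀ → ι (shiftRsop c j₀ a k) = ι (shiftRsop c j₀ a j₀) * y' k := by
    intro k hk
    have hgen := blowupAlgebra.algebraMap_mul_gen (I := maximalIdeal R) (a := c j₀) (c k) (hcm k)
    rw [hctj, shiftRsop_of_ne c j₀ a hk, hyk0 k hk, hιdef]
    simp only [RingHom.comp_apply, map_sub, map_mul, ← hgen]
    ring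
  have hσ'ι : ∀ r, σ' (ι r) = (π.stalkMap x').hom (σ r) := fun r => by
    rw [hιdef, RingHom.comp_apply]; exact h12 r
  -- the point on `ℙ(Dir)` in the shifted coordinates, rationality, nearness, embedding dimensions
  have hxAt : Ideal.span (Set.range (σ ∘ shiftRsop c j₀ a)) = maximalIdeal (Y.presheaf.stalk (π x')) :=
    span_range_comp_eq_maximalIdeal (by rw [span_range_shiftRsop, hc]) σ hσ
  have hPt : ProjDirLiftsInto (π.stalkMap x').hom (σ ∘ shiftRsop c j₀ a) hxAt := by
    have h0 : ProjDirLiftsInto (π.stalkMap x').hom (minGenerators (Y.presheaf.stalk (π x')))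
        (span_range_minGenerators (Y.presheaf.stalk (π x'))) := hon
    have hsurj : Function.Surjective (Fin.cast hdA.symm) := fun i => ⟨Fin.cast hdA i, by simp⟩
    have hr : Set.range (minGenerators (Y.presheaf.stalk (π x')) ∘ Fin.cast hdA.symm) =
        Set.range (minGenerators (Y.presheaf.stalk (π x'))) := by
      rw [Set.range_comp, hsurj.range_eq, Set.image_univ]
    have hcast : Ideal.span (Set.range (minGenerators (Y.presheaf.stalk (π x')) ∘ Fin.cast hdA.symm)) =
        maximalIdeal (Y.presheaf.stalk (π x')) :=
      (congrArg Ideal.span hr).trans (span_range_minGenerators _)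
    have h1 := (projDirLiftsInto_comp_cast_iff (π.stalkMap x').hom hdA.symm (span_range_minGenerators _) hcast).mpr h0
    exact (projDirLiftsInto_iff_of_minimal_of_isLocalHom (π.stalkMap x').hom hcast hxAt hdA).mp h1
  have hκ : Function.Bijective (IsLocalRing.ResidueField.map (π.stalkMap x').hom) := ⟨RingHom.injective _, hrat⟩
  have hH : ∀ s, hilbertFun (Y'.presheaf.stalk x') s = hilbertFun (Y.presheaf.stalk (π x')) s := fun s => by
    have h := congrFun hHS s
    simpa only [hilbertSamuelFun_zero] using h
  have hdA' : (maximalIdeal (Y'.presheaf.stalk x')).spanFinrank = d := by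
    rw [← hilbertFun_one_eq_spanFinrank, hH 1, hilbertFun_one_eq_spanFinrank, hdA]
  have he1 : Literature.RingTheory.HilbertSamuel.dirDim (Y.presheaf.stalk (π x')) = 1 := he
  have he1' : 1 ≤ Literature.RingTheory.HilbertSamuel.dirDim (Y'.presheaf.stalk x') := he'
  -- THE MECHANISM (instances of `R'` unified from the step data, as in `…E1NearStep`)
  have htrans' := @X_notMem_directrixSpace_of_stepData_ideal R (Localization.AtPrime 𝔑) (Y.presheaf.stalk (π x'))
    (Y'.presheaf.stalk x') _ _ _ _ _ _ _ _ _ _ d c hc j₀ a y' hy' ι hyj' hyk σ hσ σ' h8 (π.stalkMap x').hom _ hσ'ι h13 hPt hκ hH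
    hdA hdA' he1 he1'
  exact ⟨Localization.AtPrime 𝔑, inferInstance, h5, y', σ', hy', h8, h6, hdA', by rw [hyj, hσ'ι], hE, htrans'⟩

/-- **`exists_presentation_step_ideal` with the base point named** (`π x′ = x` as an equation; compatibilities through Mathlib's `stalkCongr`).
[OURS · L1 W4.2; AI-written] [cite: CossartJannsenSaito2020, Def. 6.34 (i), Lemma 2.7] -/
theorem exists_presentation_step_ideal_of_eq {Y Y' : Scheme.{u}} [IsLocallyNoetherian Y] [IsLocallyNoetherian Y'] {π : Y' ⟶ Y}
    {D : Y.IdealSheafData} (hπ : IsBlowup π D) (x' : Y') (x : Y) (hx : π x' = x)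
    (hD : stalkIdeal D x = maximalIdeal (Y.presheaf.stalk x))
    (hcl : IsClosed ({x} : Set Y)) (hπpt : IsBlowup π (vanishingIdeal ⟨{x}, hcl⟩))
    {R : Type u} [CommRing R] [IsRegularLocalRing R] {d : ℕ} (hd : (maximalIdeal R).spanFinrank = d)
    (c : Fin d → R) (hc : Ideal.span (Set.range c) = maximalIdeal R)
    (σ : R →+* Y.presheaf.stalk x) (hσ : Function.Surjective σ)
    (hdA : (maximalIdeal (Y.presheaf.stalk x)).spanFinrank = d) (j₀ : Fin d)
    (he : Scheme.dirDim Y x = 1) (hon : IsOnProjDirectrix π x')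
    (hHS : hilbertSamuelFun (Y'.presheaf.stalk x') 0 = hilbertSamuelFun (Y.presheaf.stalk x) 0)
    (he' : 1 ≤ Scheme.dirDim Y' x')
    (htrans : (X j₀ : MvPolynomial (Fin d) (ResidueField (Y.presheaf.stalk x))) ∉
      directrixSpace (tangentConeIdeal (σ ∘ c) (span_range_comp_eq_maximalIdeal hc σ hσ))) :
    ∃ (R' : Type u) (_ : CommRing R') (_ : IsRegularLocalRing R') (y' : Fin d → R') (σ' : R' →+* Y'.presheaf.stalk x')
      (hy' : Ideal.span (Set.range y') = maximalIdeal R') (hσ' : Function.Surjective σ'),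
      (maximalIdeal R').spanFinrank = d ∧ (maximalIdeal (Y'.presheaf.stalk x')).spanFinrank = d ∧
      σ' (y' j₀) = (π.stalkMap x').hom ((Y.presheaf.stalkCongr (.of_eq hx)).inv (σ (c j₀))) ∧
      (maximalIdeal (Y.presheaf.stalk (π x'))).map (π.stalkMap x').hom =
        Ideal.span {(π.stalkMap x').hom ((Y.presheaf.stalkCongr (.of_eq hx)).inv (σ (c j₀)))} ∧
      (X j₀ : MvPolynomial (Fin d) (ResidueField (Y'.presheaf.stalk x'))) ∉
        directrixSpace (tangentConeIdeal (σ' ∘ y') (span_range_comp_eq_maximalIdeal hy' σ' hσ')) := by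
  subst hx
  simp only [stalkCongr_inv_self_apply]
  exact exists_presentation_step_ideal hπ x' hD hcl hπpt hd c hc σ hσ hdA j₀ he hon hHS he' htrans

end Summit.ResolutionOfSingularities.ResolutionOfSingularities.Theorems.SigmaMaxModificationsCorridor3.E1Free

end
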